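import Literature.MathematicalPhysics.QuantumFieldTheory.Balaban1983to89.T4ActivityRecursion
import HarnessLib

/-!
# T⁴ spine, node U3, estimate NE5 — seat P2 (polymer-activity Lipschitz route), WITNESS LEAF: the singleton values of
# the polymer-gas functionals and an informative toy instance of `InputModel.ne5_of_model` (v1.1: + the toy scale-resolved;
# v1.2: + the toy in the Lipschitz currency, exact modulus ½ versus Cauchy's 1/(1 − ρ₀); v1.3: + a NON-HOLOMORPHIC model
# separating the Lipschitz currency from the analytic box wall BY KIND, + the toy's two-species datum)

[analysis] Cross-read advisory A2 on `T4ActivityRecursion.lean` v1 (b2b-balaban-pv19-g4, cell journal 2026-08-19): the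
reduction `InputModel.ne5_of_model` (operator rate ⊕ damped history insertion ⊕ box-KP ⟹ NE5) was certified with all its
hypotheses as BINDERS, but no instance with NONZERO activities had been exhibited — a degenerate consistency witness
(`Ψ ≡ 0`) is free, the informative one needs the value of the truncated functional `Φ^T` on a singleton.  This leaf
supplies it.  Nothing here is an estimate of [Balaban1988RG2Cluster]; the honest frame of the whole cell is unchanged
(rung (B)+1 of a finite-volume T⁴ programme; NOT infinite volume, NOT a mass gap, NOT the Clay problem).

CONTENT, all [folklore] and PROVED (0 sorry):

§1 Singleton values in the abstract polymer gas of `Literature.Probability.LatticeModels` (Kotecký–Preiss form):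
`polymerPartitionFunction_singleton` `Ξ_{{γ}}(z) = 1 + z γ`; `polymerRayDeriv_singleton`; `polymerLogZ_singleton`: the
Kotecký–Preiss logarithm of a one-polymer volume IS the principal logarithm, `log Z({γ}; w) = Log(1 + w γ)` whenever
`1 + w γ` lies in the slit plane (the defining ray integral `∫₀¹ w γ/(1 + t w γ) dt` by the fundamental theorem of calculus;
the segment `1 + t w γ`, `t ∈ [0, 1]`, stays in the slit plane, which is star-shaped at `1`); `truncatedWeight_singleton`
`Φ^T({γ}) = log Z({γ})`; `clusterSum_singleton` `E_w({{γ}}) = Φ^T({γ})`.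

§2 The toy.  On the sibling's `T4InputCauchyRate.toyCarriers` (domains = creation steps `k ∈ ℕ`, no tree length, trivial
backgrounds): ONE polymer per step (`P = ℕ`, incompatibility = equality), step volume `{k}`, localizing family `{{k}}`,
pin `k`; the two-species input model `actModel` with activities `Ψ(o, h) = o(1 + h)/8` (entire, genuinely dependent on
BOTH species), operator inputs `(1/2)^k` (run A) versus `0` (run B), the SAME history insertion for both runs reading the
newest previous scale of the run's own output table with gain `1/16`, base point `(0, 0)` and unit margins.  Run B is
identically `0`; run A's outputs are the GENUINE nonlinear recursion
`E_A(k) = log(1 + (1/2)^k (1 + E_A(k − 1)/16)/8)` (`actE`; `E_A(0) = log(9/8)`), i.e. the real part of the truncated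
functional of the one-polymer cluster with activity `r_k = (1/2)^k(1 + E_A(k − 1)/16)/8` (§1).  EVERY hypothesis of
`InputModel.ne5_of_model` is verified (`act_represents`, `act_realizes`, `act_inBase`, `act_boxKP` with majorant `1/4`,
size function `1`, no extracted decay, `act_decayExtract`, `act_pinBudget` with `A = 1`, `act_decayA` with `A₀ = 1/4`,
`act_decayB`, `act_operatorRate` (`δ = 1`, `θ = 1/2`), `act_insertionRate` (`δ′ = 0`), `act_insertionDamped` (`c = 1`,
`ω = 1/16`), smallness `(1 + 4·1·1)/16 = 5/16 < 1/2`), whence `act_ne5 : NE5 actEA actEB univ 0 (1/2) (28/3)`; and the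
instance is INFORMATIVE: the discrepancy is `E_A(k) > 0` at every scale (`act_disc_pos`), so the conclusion is not the
vacuous `0 ≤ …`, and it DECAYS at the asserted rate only because the theorem says so (`act_disc_le`).

§3 (file v1.1, ADDITIVE; generation 5) The toy, SCALE-RESOLVED against `T4ActivityRecursion` v1.2 §7: the structure
hypotheses hold (`act_insAffine`, `act_insBlind`, `act_insHomog`), the single-scale one-level term holds with natural
gain `1/16` and ANY damping `ω ≥ 0` (`act_insScaleBound` — the feed reads only the newest previous scale, the UNDAMPED
term of the printed age sum), the bound with levels and the discrepancy shape `InsertionDampedNat 0 (1/16) ω` are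
RECOVERED from them through §7 (`act_insScaleBoundLevel`, `act_insertionDampedNat`), and the scale-resolved near-regime
closure `InputModel.ne5_of_model_scale_near_nat` is exercised with every hypothesis discharged (`act_ne5_scale_near`:
`E₁ = 1`, `c = ω = 1/16`, `k₀ = 1`, `ρ₀ = 31/60` with the near condition an EQUALITY, `B = 1/4`; NE5 at rate `1/2`,
constant `1883/572`).

§4 (file v1.2, ADDITIVE; generation 6) The toy in the LIPSCHITZ CURRENCY of `T4ActivityRecursion` v1.3 §8 (the analytic
box wall re-typed without analyticity): `act_baseMajorant` (at the admissible point `(0, 0)` the activity is `0 ≤ 1/4`),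
`act_kpInflated` (Kotecký–Preiss for the INFLATED majorant `(1 + 2/5)·¼`: `(7/20)e ≤ 1`), `act_activityLipschitz`: the
two-point activity-Lipschitz datum holds with the EXACT modulus `Λ = 1/2` at EVERY reach `ρ₀ ≤ 1`
(`|q₁(1 + q₂)|/8 ≤ (|q₁| + |q₂|)/8` as `|q₁| ≤ 1`), ATTAINED along the operator axis (`act_activityLipschitz_sharp`),
against the modulus `1/(1 − ρ₀)` that the one-variable Cauchy estimate PRODUCES from the toy's analytic box wall
(`act_activityLipschitz_cauchy` = `InputModel.activityLipschitz_of_boxKP act_boxKP`: `4/3` at reach `1/4`, unbounded at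
reach `1`) — the Lipschitz datum is genuinely smaller data than holomorphy-with-Cauchy; and the closure
`InputModel.ne5_of_model_actLip_scale_nat` exercised with every hypothesis discharged (`act_ne5_actLip`: inflation
`s = 2/5`, `Λ = 1/2`, `k₀ = 2`, reach `ρ₀ = 4/15` with the near condition an EQUALITY, `B = 1/2`, key constant
`K = AΛ/(s − Λρ₀) = 15/8`, smallness `23/128 < 1/2`; NE5 at rate `1/2`, constant `133/41`; unfolded `act_disc_le_actLip`:
`0 < E_A(k) ≤ (133/41)(1/2)^k`).

§5 (file v1.3, ADDITIVE; generation 7) CLASS SEPARATION BY KIND (cross-read INFO I2 of cell GAPS C-b01g22-3: v1.2 separated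
the Lipschitz currency from the analytic box wall only in modulus and reach, the toy `Ψ` being entire).  The model
`actModelC` = `actModel` with the single change `Ψ♭(o, h) = conj(o)(1 + h)/8`: at the two runs' REAL input points its values
are `actModel`'s, so it realizes the same genuine functionals (`actC_realizes`), it carries the one-run majorant, the
inflated KP condition and the activity-Lipschitz datum with the same exact modulus `½` (`actC_baseMajorant`,
`act_kpInflated`, `actC_activityLipschitz`; `‖conj q₁‖ = ‖q₁‖`), and the Lipschitz-currency closure concludes NE5 on it with
the same constant `133/41` (`actC_ne5_actLip`) — while `actC_not_boxKP`: `BoxKP` FAILS on it for EVERY majorant and size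
data (along the operator axis the activity is `conj/8`, complex differentiable at no point: `not_differentiableAt_conj`,
Cauchy–Riemann by uniqueness of the real Fréchet derivative), so none of the closures through the analytic wall (§2–§7 of
`T4ActivityRecursion`) can be instantiated on it.  `actC_separation` states the separation in one line.  (What this
certifies is a statement about the two HYPOTHESIS CLASSES as classes of models; Bałaban's activities ARE analytic in
their inputs (B13 p. 15) — the point of the re-typing is which datum the two-run estimate CONSUMES, not a claim that
analyticity fails there.)

§6 (file v1.3, ADDITIVE; generation 7) The toy's TWO-SPECIES datum against `T4ActivityRecursion` v1.4 §9.2: the activity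
`q₁(1 + q₂)/8` feels the history only through the cross term, so at reach `ρ₀` its OPERATOR modulus is `½` and its HISTORY
modulus any `Λh ≥ ρ₀/2` (`act_activityLipschitz₂`); the species closure `InputModel.ne5_of_model_actLip₂_scale_nat`
exercised with every hypothesis discharged (`act_ne5_actLip₂`: `Λop = ½`, `Λhist = ¼` at reach `½`, regauge `l = ½`,
regauged reach `ρ₀′ = 4/15`, `k₀ = 3` with the near condition an EQUALITY, `B = 1`; key constant `K′ = 3/4` against the
single-species `15/8`, feedback gain `3/64` against `15/128`, NE5 at rate `1/2` with constant `14/5` against `133/41`;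
unfolded `act_disc_le_actLip₂`) — on the toy the species split improves both the exponent-critical gain and the constant.

Sources.  [KoteckyPreiss1986] R. Kotecký, D. Preiss, Comm. Math. Phys. 103 (1986) 491–498, §2 (the logarithm as the
continuous branch along the ray) and (3) (the truncated functional).  [Balaban1988RG2Cluster] T. Bałaban, Comm. Math.
Phys. 116 (1988) 1–22, (2.13) p. 14 (the localized cluster sum whose toy this is).  Internal: `T4ActivityRecursion.lean`
v1 (this lineage, generation 3), `T4InputCauchyRate.toyCarriers` (seat P1).

Provenance: written by agent b2b-balaban-t4-ne5-p2-g4 (planner acting as PROVER, explicit-unit mode, lineage generation 4),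
journal claim T4-U3.E-NE5-PROVE-P2d 2026-08-19; §3 by b2b-balaban-t4-ne5-p2-g5 (generation 5, claim T4-U3.E-NE5-PROVE-P2e);
§4 by b2b-balaban-t4-ne5-p2-g6 (generation 6, claim T4-U3.E-NE5-PROVE-P2f*); §5–§6 by b2b-balaban-t4-ne5-p2-g7 (generation 7,
claim T4-U3.E-NE5-PROVE-P2g*); no page of the audited manuscripts is used (pure folklore + a toy; the one locator named in
§5's summary, B13 p. 15, is that of the analyticity sentence already quoted in `T4ActivityRecursion`'s header).  VERSIONS:
v1 = p185872; v1.1 = p186982: every v1 declaration byte-identical, ADDITIVE §3; v1.2 = p187932: every v1.1 declaration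
byte-identical, ADDITIVE §4 (Internal: `T4ActivityRecursion.lean` v1.3 §8); v1.3: every v1.2 declaration byte-identical,
ADDITIVE §5–§6 (Internal: `T4ActivityRecursion.lean` v1.4 §9 = p188551; Mathlib's `Complex.conjCLE`, `HasFDerivAt.unique`).
-/

noncomputable section

open Finset Metric Set
open scoped BigOperators

open Literature.Probability.LatticeModels
open Literature.MathematicalPhysics.QuantumFieldTheory.Balaban1983to89.T4OutputRate
open Literature.MathematicalPhysics.QuantumFieldTheory.Balaban1983to89.T4InputCauchyRate
open Literature.MathematicalPhysics.QuantumFieldTheory.Balaban1983to89.T4InputCauchyRateData (tableA tableB)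
open Literature.MathematicalPhysics.QuantumFieldTheory.Balaban1983to89.T4ActivityLipschitz
open Literature.MathematicalPhysics.QuantumFieldTheory.Balaban1983to89.T4ActivityRecursion

namespace Literature.MathematicalPhysics.QuantumFieldTheory.Balaban1983to89.T4ActivityRecursionWitness

/-! ## §1 Singleton values of the polymer-gas functionals -/

section Singleton

variable {P : Type*} [DecidableEq P] {inc : P → P → Prop} [DecidableRel inc]

omit [DecidableEq P] [DecidableRel inc] in
/-- A one-polymer family is compatible. [folklore] -/
theorem isCompatible_singleton (γ : P) : IsCompatible inc ({γ} : Finset P) := by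
  unfold IsCompatible
  rw [Finset.coe_singleton]
  exact Set.pairwise_singleton γ _

/-- `Ξ_{{γ}}(z) = 1 + z γ`. [folklore] -/
theorem polymerPartitionFunction_singleton (z : P → ℂ) (γ : P) :
    polymerPartitionFunction inc z {γ} = 1 + z γ := by
  unfold polymerPartitionFunction
  have hp : ({γ} : Finset P).powerset = {∅, {γ}} := by
    ext s
    rw [Finset.mem_powerset, Finset.subset_singleton_iff, Finset.mem_insert, Finset.mem_singleton]
  have hne : (∅ : Finset P) ∉ ({{γ}} : Finset (Finset P)) := by simp
  rw [hp, Finset.sum_insert hne, Finset.sum_singleton, if_pos isCompatible_empty, if_pos (isCompatible_singleton γ)]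
  simp

/-- The ray derivative of a one-polymer volume is the activity: `d/dt Ξ_{{γ}}(t w) = w γ`. [folklore] -/
theorem polymerRayDeriv_singleton (w : P → ℂ) (γ : P) (t : ℝ) : polymerRayDeriv inc w {γ} t = w γ := by
  unfold polymerRayDeriv
  have hp : ({γ} : Finset P).powerset = {∅, {γ}} := by
    ext s
    rw [Finset.mem_powerset, Finset.subset_singleton_iff, Finset.mem_insert, Finset.mem_singleton]
  have hne : (∅ : Finset P) ∉ ({{γ}} : Finset (Finset P)) := by simp
  rw [hp, Finset.filter_insert, if_pos isCompatible_empty, Finset.filter_singleton,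
    if_pos (isCompatible_singleton γ), Finset.sum_insert hne, Finset.sum_singleton]
  simp

omit [DecidableEq P] [DecidableRel inc] in
/-- The slit plane is star-shaped at `1` towards `1 + w`: if `1 + w` avoids the closed negative real axis, so does
`1 + t w` for `t ∈ [0, 1]`. [folklore] -/
theorem one_add_mul_mem_slitPlane {w : ℂ} (h : 1 + w ∈ Complex.slitPlane) {t : ℝ} (ht0 : 0 ≤ t) (ht1 : t ≤ 1) :
    1 + (t : ℂ) * w ∈ Complex.slitPlane := by
  rw [Complex.mem_slitPlane_iff] at h ⊢
  simp only [Complex.add_re, Complex.one_re, Complex.add_im, Complex.one_im, Complex.mul_re, Complex.mul_im,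
    Complex.ofReal_re, Complex.ofReal_im, zero_mul, sub_zero, zero_add, add_zero] at h ⊢
  by_cases him : w.im = 0
  · left
    have hre : 0 < 1 + w.re := by
      rcases h with h | h
      · exact h
      · exact absurd him h
    by_cases hr : 0 ≤ w.re
    · nlinarith [mul_nonneg ht0 hr]
    · nlinarith [mul_le_mul_of_nonpos_right ht1 (not_le.mp hr).le]
  · rcases ht0.eq_or_lt with h0 | hpos
    · left
      rw [← h0]
      norm_num
    · right
      exact mul_ne_zero hpos.ne' him

/-- **The Kotecký–Preiss logarithm of a one-polymer volume is the principal logarithm**: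
`log Z({γ}; w) = Log(1 + w γ)` whenever `1 + w γ` lies in the slit plane (the defining ray integral
`∫₀¹ w γ /(1 + t w γ) dt`, evaluated by the fundamental theorem of calculus). [folklore] -/
theorem polymerLogZ_singleton {w : P → ℂ} {γ : P} (h : 1 + w γ ∈ Complex.slitPlane) :
    polymerLogZ inc w {γ} = Complex.log (1 + w γ) := by
  have hseg : ∀ t ∈ Set.uIcc (0 : ℝ) 1, 1 + (t : ℂ) * w γ ∈ Complex.slitPlane := by
    intro t ht
    rw [Set.uIcc_of_le zero_le_one] at ht
    exact one_add_mul_mem_slitPlane h ht.1 ht.2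
  have hderiv : ∀ t ∈ Set.uIcc (0 : ℝ) 1,
      HasDerivAt (fun s : ℝ => Complex.log (1 + (s : ℂ) * w γ)) (w γ / (1 + (t : ℂ) * w γ)) t := by
    intro t ht
    have h1 : HasDerivAt (fun s : ℂ => 1 + s * w γ) (w γ) (t : ℂ) := by
      simpa using ((hasDerivAt_id (t : ℂ)).mul_const (w γ)).const_add 1
    have h2 : HasDerivAt (fun s : ℝ => 1 + (s : ℂ) * w γ) (w γ) t := h1.comp_ofReal
    have h3 := (Complex.hasDerivAt_log (hseg t ht)).comp t h2
    rw [div_eq_inv_mul]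
    exact h3
  have hcont : ContinuousOn (fun t : ℝ => w γ / (1 + (t : ℂ) * w γ)) (Set.uIcc 0 1) :=
    continuousOn_const.div (by fun_prop) fun t ht => Complex.slitPlane_ne_zero (hseg t ht)
  have hint : ∀ t : ℝ, polymerRayDeriv inc w {γ} t /
      polymerPartitionFunction inc (fun γ' => (t : ℂ) * w γ') {γ} = w γ / (1 + (t : ℂ) * w γ) := by
    intro t
    rw [polymerRayDeriv_singleton, polymerPartitionFunction_singleton]
  unfold polymerLogZ
  simp_rw [hint]
  rw [intervalIntegral.integral_eq_sub_of_hasDerivAt hderiv hcont.intervalIntegrable]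
  simp

/-- `Φ^T({γ}) = log Z({γ})` (the Möbius transform on a singleton: `log Z(∅) = 0`). [folklore] -/
theorem truncatedWeight_singleton (w : P → ℂ) (γ : P) : truncatedWeight inc w {γ} = polymerLogZ inc w {γ} := by
  unfold truncatedWeight
  have hp : ({γ} : Finset P).powerset = {∅, {γ}} := by
    ext s
    rw [Finset.mem_powerset, Finset.subset_singleton_iff, Finset.mem_insert, Finset.mem_singleton]
  have hne : (∅ : Finset P) ∉ ({{γ}} : Finset (Finset P)) := by simp
  rw [hp, Finset.sum_insert hne, Finset.sum_singleton, polymerLogZ_empty]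
  simp

/-- `Φ^T({γ}) = Log(1 + w γ)` when `1 + w γ` lies in the slit plane. [folklore] -/
theorem truncatedWeight_singleton_eq_log {w : P → ℂ} {γ : P} (h : 1 + w γ ∈ Complex.slitPlane) :
    truncatedWeight inc w {γ} = Complex.log (1 + w γ) := by
  rw [truncatedWeight_singleton, polymerLogZ_singleton h]

/-- The localized cluster sum over the single one-polymer family is that polymer's truncated functional. [folklore] -/
theorem clusterSum_singleton (w : P → ℂ) (γ : P) : clusterSum inc w {{γ}} = truncatedWeight inc w {γ} := by
  unfold clusterSum
  rw [Finset.sum_singleton]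

end Singleton

/-! ## §2 The toy: one polymer per step, singleton localizing families, a genuine damped history feed -/

section Toy

/-- The toy history feed at step `k`: read the newest previous scale of the table with gain `1/16` (nothing at step 0).
[folklore] -/
def actFeed (k : ℕ) (t : ℕ → ℝ) : ℝ := if k = 0 then 0 else 1 / 16 * t (k - 1 : ℕ)

/-- Run A's toy outputs, the GENUINE nonlinear recursion `E_A(k) = log(1 + (1/2)^k(1 + E_A(k − 1)/16)/8)`,
`E_A(0) = log(9/8)`. [folklore] -/
def actE : ℕ → ℝ
  | 0 => Real.log (1 + 1 / 8)
  | k + 1 => Real.log (1 + 1 / 8 * (1 / 2 : ℝ) ^ (k + 1) * (1 + 1 / 16 * actE k))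

/-- Run A's toy polymer activity at step `k`: `r_k = (1/2)^k (1 + E_A(k − 1)/16)/8` (`r_0 = 1/8`). [folklore] -/
def actR (k : ℕ) : ℝ := 1 / 8 * (1 / 2 : ℝ) ^ k * (1 + actFeed k fun j => actE j)

/-- The recursion in closed form: `E_A(k) = log(1 + r_k)`. [folklore] -/
theorem actE_eq (k : ℕ) : actE k = Real.log (1 + actR k) := by
  cases k with
  | zero => simp [actE, actR, actFeed]
  | succ n => simp [actE, actR, actFeed]

/-- The toy outputs lie in `[0, 1/4]`. [folklore] -/
theorem actE_bounds (k : ℕ) : 0 ≤ actE k ∧ actE k ≤ 1 / 4 := by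
  induction k with
  | zero =>
    refine ⟨Real.log_nonneg (by norm_num), ?_⟩
    have := Real.log_le_sub_one_of_pos (show (0 : ℝ) < 1 + 1 / 8 by norm_num)
    simp only [actE]
    linarith
  | succ n ih =>
    have hhalf : (1 / 2 : ℝ) ^ (n + 1) ≤ 1 / 2 := by
      rw [pow_succ]
      exact mul_le_of_le_one_left (by norm_num) (pow_le_one₀ (by norm_num) (by norm_num))
    have hpow : 0 ≤ (1 / 2 : ℝ) ^ (n + 1) := by positivity
    have hr0 : 0 ≤ 1 / 8 * (1 / 2 : ℝ) ^ (n + 1) * (1 + 1 / 16 * actE n) := by nlinarith [ih.1]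
    have hr1 : 1 / 8 * (1 / 2 : ℝ) ^ (n + 1) * (1 + 1 / 16 * actE n) ≤ 1 / 4 := by nlinarith [ih.1, ih.2]
    refine ⟨Real.log_nonneg (by linarith), ?_⟩
    have := Real.log_le_sub_one_of_pos (show (0 : ℝ) < 1 + 1 / 8 * (1 / 2 : ℝ) ^ (n + 1) * (1 + 1 / 16 * actE n) by
      linarith)
    simp only [actE]
    linarith

/-- The toy activities are positive. [folklore] -/
theorem actR_pos (k : ℕ) : 0 < actR k := by
  unfold actR actFeed
  split_ifs with h
  · positivity
  · have := (actE_bounds (k - 1)).1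
    positivity

/-- The toy outputs are POSITIVE (so the two runs' discrepancy is never zero). [folklore] -/
theorem actE_pos (k : ℕ) : 0 < actE k := by
  rw [actE_eq]
  exact Real.log_pos (by linarith [actR_pos k])

/-- The toy cluster representation on `toyCarriers`: one polymer per step (`P = ℕ`, incompatibility = equality), step
volume `{k}`, the single localizing family `{{k}}`, pin `k`; run A's activities `r_k`, run B's `0`. [folklore] -/
def actRep : ClusterRep toyCarriers where
  P := ℕ
  inc := fun γ γ' => γ = γ'
  inc_refl := fun _ => rfl
  inc_symm := fun _ _ h => h.symm
  vol := fun X => {toyCarriers.scale X}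
  clus := fun X => {{toyCarriers.scale X}}
  clus_sub := fun X K hK => by
    rw [Finset.mem_singleton] at hK
    rw [hK]
  pin := fun X => toyCarriers.scale X
  pin_mem := fun X => Finset.mem_singleton_self _
  clus_pin := fun X K hK => by
    rw [Finset.mem_singleton] at hK
    exact ⟨toyCarriers.scale X, by rw [hK]; exact Finset.mem_singleton_self _, rfl⟩
  ρA := fun _ _ n => (actR n : ℂ)
  ρB := fun _ _ _ => 0

/-- The toy two-species input model: activities `Ψ(o, h) = o(1 + h)/8`, operator inputs `(1/2)^k` versus `0`, the same
newest-previous-scale history feed for both runs, base point `(0, 0)`, unit margins. [folklore] -/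
def actModel : InputModel actRep ℂ ℂ where
  Ψ := fun _ _ _ _ p => 1 / 8 * p.1 * (1 + p.2)
  opA := fun _ _ X => (((1 / 2 : ℝ) ^ toyCarriers.scale X : ℝ) : ℂ)
  opB := fun _ _ _ => 0
  insA := fun _ _ X t => ((actFeed (toyCarriers.scale X) t : ℝ) : ℂ)
  insB := fun _ _ X t => ((actFeed (toyCarriers.scale X) t : ℝ) : ℂ)
  Base := fun _ _ _ => {((0 : ℂ), (0 : ℂ))}
  ϱOp := fun _ => 1
  ϱHist := fun _ => 1
  ϱOp_pos := fun _ => one_pos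
  ϱHist_pos := fun _ => one_pos

/-- Toy run A: the recursion's outputs. [folklore] -/
def actEA : Functional toyCarriers toyCarriers.BgA := fun _ _ X => actE (toyCarriers.scale X)

/-- Toy run B: identically zero. [folklore] -/
def actEB : Functional toyCarriers toyCarriers.BgB := fun _ _ _ => 0

/-- Run A's localized output at step `k` is `Log(1 + r_k)`. [folklore] -/
theorem act_outA (g : ℕ → ℝ) (U : toyCarriers.BgB) (X : toyCarriers.Dom) :
    actRep.outA g U X = Complex.log (1 + (actR (toyCarriers.scale X) : ℂ)) := by
  have hslit : (1 : ℂ) + (actR (toyCarriers.scale X) : ℂ) ∈ Complex.slitPlane := by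
    rw [← Complex.ofReal_one, ← Complex.ofReal_add, Complex.ofReal_mem_slitPlane]
    linarith [actR_pos (toyCarriers.scale X)]
  change clusterSum actRep.inc (actRep.ρA g U) {{actRep.pin X}} = _
  rw [clusterSum_singleton, truncatedWeight_singleton_eq_log]
  · rfl
  · exact hslit

/-- Run B's localized output is `0`. [folklore] -/
theorem act_outB (g : ℕ → ℝ) (U : toyCarriers.BgB) (X : toyCarriers.Dom) : actRep.outB g U X = 0 := by
  change clusterSum actRep.inc (actRep.ρB g U) {{actRep.pin X}} = 0
  rw [clusterSum_singleton, truncatedWeight_singleton_eq_log]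
  · show Complex.log (1 + 0) = 0
    simp
  · show (1 : ℂ) + 0 ∈ Complex.slitPlane
    rw [add_zero]
    exact Complex.one_mem_slitPlane

/-- Toy: the pair IS represented by the localized cluster sums (NE5-REP holds). [folklore] -/
theorem act_represents : actRep.Represents actEA actEB := by
  refine ⟨fun g U X => ?_, fun g U X => ?_⟩
  · rw [act_outA, ← Complex.ofReal_one, ← Complex.ofReal_add, Complex.log_ofReal_re]
    exact actE_eq _
  · rw [act_outB]
    rfl

/-- The toy feed of run A's own table at step `k` is the feed of the recursion. [folklore] -/
theorem actFeed_tableA (g : ℕ → ℝ) (U : toyCarriers.BgB) (k : ℕ) :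
    actFeed k (tableA actEA g U) = actFeed k fun j => actE j := rfl

/-- The toy feed of run B's (zero) table vanishes. [folklore] -/
theorem actFeed_tableB (g : ℕ → ℝ) (U : toyCarriers.BgB) (k : ℕ) : actFeed k (tableB actEB g U) = 0 := by
  unfold actFeed tableB actEB
  split_ifs <;> simp

/-- Run B's toy input point is the base point `(0, 0)`. [folklore] -/
theorem act_pointB (g : ℕ → ℝ) (U : toyCarriers.BgB) (X : toyCarriers.Dom) :
    actModel.pointB actEB g U X = (0, 0) := by
  show ((0 : ℂ), ((actFeed (toyCarriers.scale X) (tableB actEB g U) : ℝ) : ℂ)) = (0, 0)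
  rw [actFeed_tableB, Complex.ofReal_zero]

/-- Run A's toy input point. [folklore] -/
theorem act_pointA (g : ℕ → ℝ) (U : toyCarriers.BgB) (X : toyCarriers.Dom) :
    actModel.pointA actEA g U X =
      ((((1 / 2 : ℝ) ^ toyCarriers.scale X : ℝ) : ℂ), ((actFeed (toyCarriers.scale X) (fun j => actE j) : ℝ) : ℂ)) := by
  show ((((1 / 2 : ℝ) ^ toyCarriers.scale X : ℝ) : ℂ), ((actFeed (toyCarriers.scale X) (tableA actEA g U) : ℝ) : ℂ)) = _
  rw [actFeed_tableA]

/-- Toy: the activities ARE the values of `Ψ` at the two runs' own input points (`Realizes` holds) — for run A this is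
the recursion. [folklore] -/
theorem act_realizes : actModel.Realizes actEA actEB Set.univ := by
  intro g _ U X γ hγ
  have hγ' : γ = toyCarriers.scale X := Finset.mem_singleton.1 hγ
  refine ⟨?_, ?_⟩
  · rw [act_pointB]
    show 1 / 8 * (0 : ℂ) * (1 + 0) = 0
    ring
  · rw [act_pointA, hγ']
    show 1 / 8 * (((1 / 2 : ℝ) ^ toyCarriers.scale X : ℝ) : ℂ) *
        (1 + ((actFeed (toyCarriers.scale X) (fun j => actE j) : ℝ) : ℂ)) = (actR (toyCarriers.scale X) : ℂ)
    unfold actR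
    push_cast
    ring

/-- Toy: run B's input point is admissible. [folklore] -/
theorem act_inBase : actModel.InBase actEB Set.univ := by
  intro g _ U X
  rw [act_pointB]
  rfl

/-- Toy: `Ψ(o, h) = o(1 + h)/8` is entire and bounded by `1/4` on the unit two-margin box around `(0, 0)`, and the
constant majorant `1/4` obeys the Kotecký–Preiss condition with size function `1` in the one-polymer volume
(`e/4 ≤ 1`). [folklore] -/
theorem act_boxKP : actModel.BoxKP Set.univ (fun _ _ _ => 1 / 4) (fun _ => 1) (fun _ => 0) := by
  refine ⟨fun _ => zero_le_one, fun _ => le_rfl, fun g _ U X => ⟨fun p hp => ⟨fun γ _ => ?_, fun q hq γ _ => ?_⟩, ?_⟩⟩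
  · show DifferentiableOn ℂ (fun p : ℂ × ℂ => 1 / 8 * p.1 * (1 + p.2)) _
    exact ((differentiable_fst.const_mul _).mul (differentiable_snd.const_add _)).differentiableOn
  · have hp' : p = (0, 0) := hp
    subst hp'
    simp only [InputModel.box, actModel, Set.mem_prod, mem_ball, dist_zero_right] at hq
    show ‖1 / 8 * q.1 * (1 + q.2)‖ ≤ 1 / 4
    have h2 : ‖1 + q.2‖ ≤ 2 := (norm_add_le _ _).trans (by rw [norm_one]; linarith [hq.2])
    calc ‖1 / 8 * q.1 * (1 + q.2)‖ = 1 / 8 * ‖q.1‖ * ‖1 + q.2‖ := by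
          rw [norm_mul, norm_mul]
          norm_num
      _ ≤ 1 / 8 * 1 * 2 := by gcongr; exact hq.1.le
      _ = 1 / 4 := by norm_num
  · intro γ hγ
    have hγ' : γ = toyCarriers.scale X := Finset.mem_singleton.1 hγ
    change ∑ γ' ∈ ({actRep.pin X} : Finset actRep.P) with actRep.inc γ' γ, (1 / 4 : ℝ) * Real.exp (1 + 0) ≤ 1
    have hinc : actRep.inc (actRep.pin X) γ := hγ'.symm
    rw [Finset.filter_singleton, if_pos hinc, Finset.sum_singleton, add_zero]
    have := Real.exp_one_lt_d9
    linarith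

/-- Toy: the single localizing family carries (at least) the extracted decay `0`. [folklore] -/
theorem act_decayExtract : actRep.DecayExtract (fun _ => 0) (fun _ => 0) := by
  intro X K _
  simp

/-- Toy: pin budget `1 · e^0 ≤ 1 · e^{−0·d}` (`A = 1`, `κ = 0`). [folklore] -/
theorem act_pinBudget : actRep.PinBudget (fun _ => 1) (fun _ => 0) 1 0 := by
  intro X
  simp

/-- Toy: run A's one-run bound with level `1/4`. [folklore] -/
theorem act_decayA : DecayBound actEA Set.univ (1 / 4) 0 := by
  intro g _ U X
  simp only [actEA, zero_mul, neg_zero, Real.exp_zero, mul_one]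
  rw [abs_of_nonneg (actE_bounds _).1]
  exact (actE_bounds _).2

/-- Toy: run B's one-run bound with level `0`. [folklore] -/
theorem act_decayB : DecayBound actEB Set.univ 0 0 := by
  intro g _ U X
  simp [actEB]

/-- Toy: operator discrepancy `(1/2)^k` = one margin times rate `(1/2)^k` (`δ = 1`, `θ = 1/2`). [folklore] -/
theorem act_operatorRate : actModel.OperatorRate Set.univ 1 (1 / 2) := by
  intro g _ U X
  show ‖(((1 / 2 : ℝ) ^ toyCarriers.scale X : ℝ) : ℂ) - 0‖ ≤ 1 * (1 / 2) ^ toyCarriers.scale X * 1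
  rw [sub_zero, Complex.norm_real, Real.norm_eq_abs, abs_of_nonneg (by positivity)]
  linarith

/-- Toy: the two runs insert identically (`δ′ = 0`). [folklore] -/
theorem act_insertionRate : actModel.InsertionRate Set.univ 0 0 0 (1 / 2) := by
  intro g _ U X t _
  show ‖((actFeed (toyCarriers.scale X) t : ℝ) : ℂ) - ((actFeed (toyCarriers.scale X) t : ℝ) : ℂ)‖ ≤
    0 * (1 / 2) ^ toyCarriers.scale X * 1
  simp

/-- Toy: the feed reads only the newest previous scale, with gain `1/16 = ω^1` (`c = 1`, `ω = 1/16`). [folklore] -/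
theorem act_insertionDamped : actModel.InsertionDamped Set.univ 0 1 (1 / 16) := by
  intro g _ U X t t' D hD ht
  show ‖((actFeed (toyCarriers.scale X) t : ℝ) : ℂ) - ((actFeed (toyCarriers.scale X) t' : ℝ) : ℂ)‖ ≤
    1 * (1 * ∑ j ∈ range (toyCarriers.scale X), (1 / 16 : ℝ) ^ (toyCarriers.scale X - j) * D j)
  change ℕ at X
  change ∀ Y : ℕ, Y < X → |t Y - t' Y| ≤ D Y * Real.exp (-(0 * (0 : ℝ))) at ht
  change ℕ → ℝ at t t'
  show ‖((actFeed X t : ℝ) : ℂ) - ((actFeed X t' : ℝ) : ℂ)‖ ≤ 1 * (1 * ∑ j ∈ range X, (1 / 16 : ℝ) ^ (X - j) * D j)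
  cases X with
  | zero => simp [actFeed]
  | succ n =>
    have hY : |t n - t' n| ≤ D n * Real.exp (-(0 * (0 : ℝ))) := ht n (Nat.lt_succ_self n)
    rw [zero_mul, neg_zero, Real.exp_zero, mul_one] at hY
    have hterm : (1 / 16 : ℝ) ^ (n + 1 - n) * D n ≤ ∑ j ∈ range (n + 1), (1 / 16 : ℝ) ^ (n + 1 - j) * D j :=
      single_le_sum (f := fun j => (1 / 16 : ℝ) ^ (n + 1 - j) * D j)
        (fun j hj => mul_nonneg (pow_nonneg (by norm_num) _) (hD j (mem_range.1 hj))) (self_mem_range_succ n)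
    rw [Nat.add_sub_cancel_left, pow_one] at hterm
    have hne : n + 1 ≠ 0 := Nat.succ_ne_zero n
    simp only [actFeed, hne, if_false, Nat.add_sub_cancel]
    rw [← Complex.ofReal_sub, Complex.norm_real, Real.norm_eq_abs, ← mul_sub, abs_mul,
      abs_of_pos (by norm_num : (0 : ℝ) < 1 / 16)]
    have := mul_le_mul_of_nonneg_left hY (by norm_num : (0 : ℝ) ≤ 1 / 16)
    linarith

/-- **An informative instance of `InputModel.ne5_of_model`**: every hypothesis holds on the toy (`A = 1`, `A₀ = 1/4`,
`E₀ = 0`, `κ = 0`, `δ = 1`, `δ′ = 0`, `θ = 1/2`, `c = 1`, `ω = 1/16`; smallness `(1 + 4·1·1)/16 = 5/16 < 1/2`), so the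
toy pair — run A's outputs being the real parts of GENUINE one-polymer truncated functionals fed by their own history —
satisfies NE5 with rate `1/2` and constant `4·(7/16)/(3/16) = 28/3`. [folklore] -/
theorem act_ne5 : NE5 actEA actEB (Set.univ : Set (ℕ → ℝ)) 0 (1 / 2)
    (4 * 1 * (1 + 0) * (1 / 2 - 1 / 16) / (1 / 2 - (1 + 4 * 1 * 1) * (1 / 16))) :=
  actModel.ne5_of_model act_represents act_realizes act_inBase act_boxKP act_decayExtract act_pinBudget act_decayA
    (by norm_num) act_decayB act_operatorRate act_insertionRate act_insertionDamped zero_le_one (by norm_num)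
    zero_le_one (by norm_num) (by norm_num)

/-- The toy constant in lowest terms. [folklore] -/
example : (4 * 1 * (1 + 0) * (1 / 2 - 1 / 16) / (1 / 2 - (1 + 4 * 1 * 1) * (1 / 16)) : ℝ) = 28 / 3 := by norm_num

/-- INFORMATIVE: the two toy runs' discrepancy at every domain is `E_A(k) > 0` — the conclusion of `act_ne5` is not the
vacuous one. [folklore] -/
theorem act_disc_pos (g : ℕ → ℝ) (U : toyCarriers.BgB) (X : toyCarriers.Dom) : 0 < disc actEA actEB g U X := by
  show 0 < |actE (toyCarriers.scale X) - 0|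
  rw [sub_zero, abs_of_pos (actE_pos _)]
  exact actE_pos _

/-- The toy NE5 unfolded: `0 < E_A(k) ≤ (28/3)(1/2)^k`. [folklore] -/
theorem act_disc_le (k : ℕ) : actE k ≤ 28 / 3 * (1 / 2 : ℝ) ^ k := by
  have hc : (4 * 1 * (1 + 0) * (1 / 2 - 1 / 16) / (1 / 2 - (1 + 4 * 1 * 1) * (1 / 16)) : ℝ) = 28 / 3 := by norm_num
  have h : |actE k - 0| ≤
      4 * 1 * (1 + 0) * (1 / 2 - 1 / 16) / (1 / 2 - (1 + 4 * 1 * 1) * (1 / 16)) * (1 / 2 : ℝ) ^ k *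
        Real.exp (-(0 * (0 : ℝ))) :=
    act_ne5 (fun _ => 1) (Set.mem_univ _) () k
  rw [hc, sub_zero, abs_of_pos (actE_pos k), zero_mul, neg_zero, Real.exp_zero, mul_one] at h
  exact h

end Toy

/-! ## §3 (file v1.1, ADDITIVE) The toy, scale-resolved: the structure hypotheses of `T4ActivityRecursion` §7 hold,
## the discrepancy shape is RECOVERED from them, and the scale-resolved closure is exercised -/

section ToyScale

/-- The toy feed of the zero table vanishes. [folklore] -/
theorem actFeed_zero (k : ℕ) : actFeed k 0 = 0 := by
  unfold actFeed
  split_ifs <;> simp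

/-- The toy feed is additive (indeed linear) in the table. [folklore] -/
theorem actFeed_sub (k : ℕ) (t t' : ℕ → ℝ) : actFeed k (t - t') = actFeed k t - actFeed k t' := by
  unfold actFeed
  split_ifs <;> simp [mul_sub]

/-- The toy feed is real-homogeneous in the table. [folklore] -/
theorem actFeed_smul (k : ℕ) (a : ℝ) (t : ℕ → ℝ) : actFeed k (a • t) = a * actFeed k t := by
  unfold actFeed
  split_ifs <;> simp [mul_left_comm]

/-- The toy feed at step `k` reads only the entries below `k`. [folklore] -/
theorem actFeed_congr (k : ℕ) {t t' : ℕ → ℝ} (h : ∀ j < k, t j = t' j) : actFeed k t = actFeed k t' := by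
  cases k with
  | zero => simp [actFeed]
  | succ n => simp [actFeed, h n (Nat.lt_succ_self n)]

/-- Toy: the insertion is AFFINE in the table (`InsAffine`). [folklore] -/
theorem act_insAffine : actModel.InsAffine Set.univ := by
  intro g _ U X t t'
  change ℕ at X
  change ℕ → ℝ at t t'
  show ((actFeed X t : ℝ) : ℂ) - ((actFeed X t' : ℝ) : ℂ) = ((actFeed X (t - t') : ℝ) : ℂ) - ((actFeed X 0 : ℝ) : ℂ)
  rw [actFeed_sub, actFeed_zero, Complex.ofReal_sub, Complex.ofReal_zero, sub_zero]

/-- Toy: the insertion is BLIND to the scales `≥` the created one (`InsBlind`). [folklore] -/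
theorem act_insBlind : actModel.InsBlind Set.univ := by
  intro g _ U X t t' h
  change ℕ at X
  change ℕ → ℝ at t t'
  change ∀ Y : ℕ, Y < X → t Y = t' Y at h
  show ((actFeed X t : ℝ) : ℂ) = ((actFeed X t' : ℝ) : ℂ)
  rw [actFeed_congr X h]

/-- Toy: the table-driven part is REAL-HOMOGENEOUS (`InsHomog`). [folklore] -/
theorem act_insHomog : actModel.InsHomog Set.univ := by
  intro g _ U X a t
  change ℕ at X
  change ℕ → ℝ at t
  show ((actFeed X (a • t) : ℝ) : ℂ) - ((actFeed X 0 : ℝ) : ℂ) = (a : ℂ) • (((actFeed X t : ℝ) : ℂ) - ((actFeed X 0 : ℝ) : ℂ))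
  rw [actFeed_smul, actFeed_zero, Complex.ofReal_zero, sub_zero, sub_zero, Complex.ofReal_mul, smul_eq_mul]

/-- Toy: the SINGLE-SCALE bound at any level `E₁ ≥ 0` with natural gain `1/16` and ANY damping `ω ≥ 0` — the feed reads
only the newest previous scale, i.e. only the UNDAMPED term `j = scale X − 1` of the printed age sum is present
(`InsScaleBound 0 E₁ (1/16) ω`). [folklore] -/
theorem act_insScaleBound {E₁ ω : ℝ} (hE₁ : 0 ≤ E₁) (hω : 0 ≤ ω) : actModel.InsScaleBound Set.univ 0 E₁ (1 / 16) ω := by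
  intro g _ U X t j hj hsupp hlev
  change ℕ at X
  change ℕ → ℝ at t
  change j < X at hj
  change ∀ Y : ℕ, Y ≠ j → t Y = 0 at hsupp
  change ∀ Y : ℕ, Y = j → |t Y| ≤ E₁ * Real.exp (-(0 * (0 : ℝ))) at hlev
  show ‖((actFeed X t : ℝ) : ℂ) - ((actFeed X 0 : ℝ) : ℂ)‖ ≤ 1 * (1 / 16 * (ω ^ (X - 1 - j) * E₁))
  rw [actFeed_zero, Complex.ofReal_zero, sub_zero, Complex.norm_real, Real.norm_eq_abs]
  cases X with
  | zero => exact absurd hj (Nat.not_lt_zero j)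
  | succ n =>
    simp only [actFeed, Nat.succ_ne_zero, if_false, Nat.add_sub_cancel]
    by_cases hn : n = j
    · have h := hlev n hn
      rw [zero_mul, neg_zero, Real.exp_zero, mul_one] at h
      rw [hn, Nat.sub_self, pow_zero, one_mul, abs_mul, abs_of_pos (by norm_num : (0 : ℝ) < 1 / 16)]
      rw [hn] at h
      linarith
    · rw [hsupp n hn, mul_zero, abs_zero]
      exact mul_nonneg zero_le_one (mul_nonneg (by norm_num) (mul_nonneg (pow_nonneg hω _) hE₁))

/-- Toy: the single-scale bound WITH LEVELS, obtained from the one-level bound by homogeneity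
(`InputModel.insScaleBoundLevel_iff_of_homog`). [folklore] -/
theorem act_insScaleBoundLevel {ω : ℝ} (hω : 0 ≤ ω) : actModel.InsScaleBoundLevel Set.univ 0 (1 / 16) ω :=
  (actModel.insScaleBoundLevel_iff_of_homog act_insHomog one_pos).2 (act_insScaleBound zero_le_one hω)

/-- Toy: the DISCREPANCY SHAPE in the printed age normalisation RECOVERED from structure + the one-level term
(`InputModel.insertionDampedNat_of_scaleBound`): natural gain `1/16`, any damping `ω ≥ 0`. [folklore] -/
theorem act_insertionDampedNat {ω : ℝ} (hω : 0 ≤ ω) : actModel.InsertionDampedNat Set.univ 0 (1 / 16) ω :=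
  actModel.insertionDampedNat_of_scaleBound act_insAffine act_insBlind act_insHomog (act_insScaleBound zero_le_one hω)
    one_pos

/-- **The scale-resolved near-regime closure exercised**: every hypothesis of `InputModel.ne5_of_model_scale_near_nat`
holds on the toy (`A = 1`, `A₀ = 1/4`, `E₀ = 0`, `E₁ = 1`, `κ = 0`, `δ = 1`, `δ′ = 0`, `θ = 1/2`, `c = 1/16`,
`ω = 1/16`, `k₀ = 1`, `ρ₀ = 31/60` — the near condition `½ + (1/16)(1/4)/(15/16) = 31/60` holds with equality —
`B = 1/4`; smallness `1/16 + (60/29)/16 = 89/464 < 1/2`), whence NE5 at rate `1/2` with the closure's constant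
(`= 1883/572`, next example). [folklore] -/
theorem act_ne5_scale_near : NE5 actEA actEB (Set.univ : Set (ℕ → ℝ)) 0 (1 / 2)
    ((1 / (1 - 31 / 60) * (1 + 0) + 1 / 4) * (1 / 2 - 1 / 16) / (1 / 2 - (1 / 16 + 1 / (1 - 31 / 60) * (1 / 16)))) :=
  actModel.ne5_of_model_scale_near_nat (k₀ := 1) act_represents act_realizes act_inBase act_boxKP act_decayExtract
    act_pinBudget act_decayA act_decayB act_operatorRate act_insertionRate act_insAffine act_insBlind act_insHomog
    (act_insScaleBound zero_le_one (by norm_num : (0 : ℝ) ≤ 1 / 16)) one_pos zero_le_one (by norm_num) (by norm_num)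
    (by norm_num) (by norm_num) (by norm_num) (by norm_num) (by norm_num) (by norm_num)
    (fun k hk => by
      have hk0 : k = 0 := by omega
      subst hk0
      norm_num)
    (by norm_num)

/-- The constant in lowest terms. [folklore] -/
example : ((1 / (1 - 31 / 60) * (1 + 0) + 1 / 4) * (1 / 2 - 1 / 16) / (1 / 2 - (1 / 16 + 1 / (1 - 31 / 60) * (1 / 16))) : ℝ)
    = 1883 / 572 := by norm_num

end ToyScale

/-! ## §4 (file v1.2, ADDITIVE) The toy in the LIPSCHITZ CURRENCY of `T4ActivityRecursion` v1.3 §8: one-run majorant at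
## the admissible point, inflated Kotecký–Preiss, the activity-Lipschitz datum with its EXACT modulus `1/2` at every
## reach (versus the Cauchy-produced `1/(1 − ρ₀)`), and the closure `ne5_of_model_actLip_scale_nat` exercised -/

section ToyLipschitz

/-- Toy: at the admissible input point `(0, 0)` every activity is `0`, under the majorant `1/4`. [folklore] -/
theorem act_baseMajorant : actModel.BaseMajorant Set.univ (fun _ _ _ => 1 / 4) := by
  intro g _ U X p hp γ _
  have hp' : p = (0, 0) := hp
  subst hp'
  show ‖1 / 8 * (0 : ℂ) * (1 + 0)‖ ≤ 1 / 4
  norm_num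

/-- Toy: the Kotecký–Preiss condition for the INFLATED majorant `(1 + 2/5)·(1/4)` with size function `1` and no extracted
decay, on the one-polymer volume: `(7/20)·e ≤ 1`, i.e. `e ≤ 20/7` (`e < 2.7182818286`). [folklore] -/
theorem act_kpInflated : KPInflated actRep Set.univ (fun _ _ _ => 1 / 4) (2 / 5) (fun _ => 1) (fun _ => 0) := by
  refine ⟨fun _ => zero_le_one, fun _ => le_rfl, fun g _ U X γ hγ => ?_⟩
  have hγ' : γ = toyCarriers.scale X := Finset.mem_singleton.1 hγ
  change ∑ γ' ∈ ({actRep.pin X} : Finset actRep.P) with actRep.inc γ' γ,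
    (1 + 2 / 5) * (1 / 4 : ℝ) * Real.exp (1 + 0) ≤ 1
  have hinc : actRep.inc (actRep.pin X) γ := hγ'.symm
  rw [Finset.filter_singleton, if_pos hinc, Finset.sum_singleton, add_zero]
  have := Real.exp_one_lt_d9
  linarith

/-- Toy: the ACTIVITY-LIPSCHITZ DATUM with the EXACT modulus `Λ = 1/2` at EVERY reach `ρ₀ ≤ 1` (margins `1`, base point
`(0, 0)`, majorant `1/4`): `|q₁(1 + q₂)|/8 ≤ (|q₁| + |q₁||q₂|)/8 ≤ (|q₁| + |q₂|)/8 = ½·ρ(q, 0)·¼` because `|q₁| ≤ ρ₀ ≤ 1`.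
No analyticity is used; compare `act_activityLipschitz_cauchy` (modulus `1/(1 − ρ₀)` from the analytic box wall, blowing
up at reach `1`). [folklore] -/
theorem act_activityLipschitz {ρ₀ : ℝ} (hρ₀ : ρ₀ ≤ 1) :
    actModel.ActivityLipschitz Set.univ (fun _ _ _ => 1 / 4) (1 / 2) ρ₀ := by
  intro g _ U X p hp q hq γ _
  have hp' : p = (0, 0) := hp
  subst hp'
  have hrel : relDisc q ((0 : ℂ), (0 : ℂ)) (actModel.ϱOp X) (actModel.ϱHist X) = ‖q.1‖ + ‖q.2‖ := by
    show ‖q.1 - 0‖ / 1 + ‖q.2 - 0‖ / 1 = ‖q.1‖ + ‖q.2‖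
    rw [sub_zero, sub_zero, div_one, div_one]
  rw [hrel] at hq ⊢
  show ‖1 / 8 * q.1 * (1 + q.2) - 1 / 8 * 0 * (1 + 0)‖ ≤ 1 / 2 * (‖q.1‖ + ‖q.2‖) * (1 / 4)
  have h1 : ‖q.1‖ ≤ 1 := by linarith [norm_nonneg q.2]
  have h2 : ‖q.1‖ * ‖q.2‖ ≤ ‖q.2‖ := by nlinarith [norm_nonneg q.2, norm_nonneg q.1]
  have h3 : ‖1 + q.2‖ ≤ 1 + ‖q.2‖ := (norm_add_le _ _).trans (by rw [norm_one])
  calc ‖1 / 8 * q.1 * (1 + q.2) - 1 / 8 * 0 * (1 + 0)‖ = 1 / 8 * (‖q.1‖ * ‖1 + q.2‖) := by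
        rw [mul_zero, zero_mul, sub_zero, norm_mul, norm_mul]
        norm_num
        ring
    _ ≤ 1 / 8 * (‖q.1‖ * (1 + ‖q.2‖)) := by gcongr
    _ ≤ 1 / 2 * (‖q.1‖ + ‖q.2‖) * (1 / 4) := by nlinarith [norm_nonneg q.1]

/-- The modulus `1/2` is ATTAINED along the operator axis: `q = (r, 0)`, `r ≥ 0`, moves the activity by exactly
`r/8 = ½·ρ(q, 0)·¼`. [folklore] -/
theorem act_activityLipschitz_sharp (g : ℕ → ℝ) (U : toyCarriers.BgB) (X : toyCarriers.Dom) {r : ℝ} (hr : 0 ≤ r) :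
    ‖actModel.Ψ g U X (toyCarriers.scale X) ((r : ℂ), 0) - actModel.Ψ g U X (toyCarriers.scale X) (0, 0)‖ =
      1 / 2 * relDisc ((r : ℂ), (0 : ℂ)) ((0 : ℂ), (0 : ℂ)) (actModel.ϱOp X) (actModel.ϱHist X) * (1 / 4) := by
  have hL : actModel.Ψ g U X (toyCarriers.scale X) ((r : ℂ), 0) - actModel.Ψ g U X (toyCarriers.scale X) (0, 0) =
      ((r / 8 : ℝ) : ℂ) := by
    show 1 / 8 * (r : ℂ) * (1 + 0) - 1 / 8 * 0 * (1 + 0) = ((r / 8 : ℝ) : ℂ)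
    push_cast
    ring
  have hR : relDisc ((r : ℂ), (0 : ℂ)) ((0 : ℂ), (0 : ℂ)) (actModel.ϱOp X) (actModel.ϱHist X) = r := by
    show ‖(r : ℂ) - 0‖ / 1 + ‖(0 : ℂ) - 0‖ / 1 = r
    rw [sub_zero, sub_zero, norm_zero, zero_div, add_zero, div_one, Complex.norm_real, Real.norm_eq_abs,
      abs_of_nonneg hr]
  rw [hL, hR, Complex.norm_real, Real.norm_eq_abs, abs_of_nonneg (by positivity)]
  ring

/-- For comparison: the datum PRODUCED from the toy's analytic box wall `act_boxKP` by the one-variable Cauchy estimate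
(`InputModel.activityLipschitz_of_boxKP`) has modulus `1/(1 − ρ₀)` — `4/3` at reach `1/4`, `∞` at reach `1` — where the
exact one is `1/2`. [folklore] -/
theorem act_activityLipschitz_cauchy {ρ₀ : ℝ} (hρ₀ : ρ₀ < 1) :
    actModel.ActivityLipschitz Set.univ (fun _ _ _ => 1 / 4) (1 / (1 - ρ₀)) ρ₀ :=
  actModel.activityLipschitz_of_boxKP act_boxKP hρ₀

/-- **The Lipschitz-currency closure exercised**: every hypothesis of `InputModel.ne5_of_model_actLip_scale_nat` holds on
the toy (`A = 1`, `A₀ = 1/4`, `E₀ = 0`, `E₁ = 1`, `κ = 0`, `δ = 1`, `δ′ = 0`, `θ = 1/2`, `c = ω = 1/16`, majorant `1/4`,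
inflation `s = 2/5`, modulus `Λ = 1/2`, `k₀ = 2`, reach `ρ₀ = 4/15` — the near condition `¼ + (1/16)(1/4)/(15/16) = 4/15`
holds with EQUALITY — `B = 1/2`; key constant `K = AΛ/(s − Λρ₀) = (1/2)/(4/15) = 15/8`; smallness `1/16 + 15/128 =
23/128 < 1/2`), whence NE5 at rate `1/2` with the closure's constant (`= 133/41`, next example). [folklore] -/
theorem act_ne5_actLip : NE5 actEA actEB (Set.univ : Set (ℕ → ℝ)) 0 (1 / 2)
    ((1 * (1 / 2) / (2 / 5 - 1 / 2 * (4 / 15)) * (1 + 0) + 1 / 2) * (1 / 2 - 1 / 16) /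
      (1 / 2 - (1 / 16 + 1 * (1 / 2) / (2 / 5 - 1 / 2 * (4 / 15)) * (1 / 16)))) :=
  actModel.ne5_of_model_actLip_scale_nat (k₀ := 2) (ρ₀ := 4 / 15) (B := 1 / 2) act_represents act_realizes act_inBase
    act_baseMajorant act_kpInflated (act_activityLipschitz (by norm_num)) act_decayExtract act_pinBudget act_decayA
    act_decayB
    act_operatorRate act_insertionRate act_insAffine act_insBlind act_insHomog
    (act_insScaleBound zero_le_one (by norm_num : (0 : ℝ) ≤ 1 / 16)) one_pos zero_le_one (by norm_num) (by norm_num)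
    (by norm_num) (by norm_num) (by norm_num) (by norm_num) (by norm_num) (by norm_num) (by norm_num)
    (fun k hk => by
      interval_cases k <;> norm_num)
    (by norm_num)

/-- The constant in lowest terms. [folklore] -/
example : (((1 * (1 / 2) / (2 / 5 - 1 / 2 * (4 / 15)) * (1 + 0) + 1 / 2) * (1 / 2 - 1 / 16) /
      (1 / 2 - (1 / 16 + 1 * (1 / 2) / (2 / 5 - 1 / 2 * (4 / 15)) * (1 / 16)))) : ℝ) = 133 / 41 := by
  norm_num

/-- The toy NE5 in the Lipschitz currency, unfolded: `0 < E_A(k) ≤ (133/41)(1/2)^k`. [folklore] -/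
theorem act_disc_le_actLip (k : ℕ) : actE k ≤ 133 / 41 * (1 / 2 : ℝ) ^ k := by
  have hc : (((1 * (1 / 2) / (2 / 5 - 1 / 2 * (4 / 15)) * (1 + 0) + 1 / 2) * (1 / 2 - 1 / 16) /
      (1 / 2 - (1 / 16 + 1 * (1 / 2) / (2 / 5 - 1 / 2 * (4 / 15)) * (1 / 16)))) : ℝ) = 133 / 41 := by
    norm_num
  have h := act_ne5_actLip (fun _ => 1) (Set.mem_univ _) () k
  rw [hc] at h
  change |actE k - 0| ≤ 133 / 41 * (1 / 2 : ℝ) ^ k * Real.exp (-(0 * (0 : ℝ))) at h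
  rw [sub_zero, abs_of_pos (actE_pos k), zero_mul, neg_zero, Real.exp_zero, mul_one] at h
  exact h

end ToyLipschitz

/-! ## §5 (file v1.3, ADDITIVE) CLASS SEPARATION BY KIND: a NON-HOLOMORPHIC model of the re-typed wall of
`T4ActivityRecursion` §8 (one-run majorant ∧ inflated KP ∧ activity-Lipschitz datum, NE5 concluded) on which the analytic
box wall `BoxKP` fails for every majorant and size data (cross-read INFO I2 of cell GAPS C-b01g22-3 certified) -/

section ToyNonHolomorphic

open scoped ComplexConjugate

/-- Complex conjugation is complex differentiable at NO point (kernel; Cauchy–Riemann in one line: a ℂ-linear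
derivative `D` would have `D(I) = I·D(1)`, whereas the real derivative of `conj` is `conj` itself, `conj I = −I`,
`conj 1 = 1`). [folklore] -/
theorem not_differentiableAt_conj (z : ℂ) : ¬ DifferentiableAt ℂ (fun w : ℂ => conj w) z := by
  intro h
  have h1 : HasFDerivAt (fun w : ℂ => conj w) ((fderiv ℂ (fun w : ℂ => conj w) z).restrictScalars ℝ) z :=
    h.hasFDerivAt.restrictScalars ℝ
  have h2 : HasFDerivAt (fun w : ℂ => conj w) (Complex.conjCLE : ℂ →L[ℝ] ℂ) z := by
    have hfun : (fun w : ℂ => conj w) = (Complex.conjCLE : ℂ → ℂ) := by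
      funext w; rw [Complex.conjCLE_apply]
    rw [hfun]
    exact Complex.conjCLE.hasFDerivAt
  have huniq := h1.unique h2
  set D := fderiv ℂ (fun w : ℂ => conj w) z with hD
  have hone : D 1 = 1 := by
    have h := congrArg (fun f : ℂ →L[ℝ] ℂ => f 1) huniq
    rw [ContinuousLinearMap.coe_restrictScalars', ContinuousLinearEquiv.coe_coe, Complex.conjCLE_apply,
      map_one (starRingEnd ℂ)] at h
    exact h
  have hI : D Complex.I = -Complex.I := by
    have h := congrArg (fun f : ℂ →L[ℝ] ℂ => f Complex.I) huniq
    rw [ContinuousLinearMap.coe_restrictScalars', ContinuousLinearEquiv.coe_coe, Complex.conjCLE_apply,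
      Complex.conj_I] at h
    exact h
  have hI' : D Complex.I = Complex.I := by
    rw [← mul_one Complex.I, ← smul_eq_mul, D.map_smul, hone]
  have h2 : Complex.I + Complex.I = 0 := by nth_rewrite 1 [← hI']; rw [hI, neg_add_cancel]
  exact Complex.I_ne_zero (by linear_combination h2 / 2)

/-- The NON-HOLOMORPHIC toy input model: the data of `actModel` with the single change
`Ψ♭(o, h) = conj(o)(1 + h)/8` — the activity depends on the operator input through its COMPLEX CONJUGATE.  On the two
runs' (real) input points its values are those of `actModel`, so it realizes the SAME genuine one-polymer functionals;
it carries the activity-Lipschitz datum with the same exact modulus `1/2`; and it is complex differentiable on NO box,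
so the analytic wall `BoxKP` fails for it with EVERY majorant and size data. [folklore] -/
noncomputable def actModelC : InputModel actRep ℂ ℂ :=
  { actModel with Ψ := fun _ _ _ _ p => 1 / 8 * conj p.1 * (1 + p.2) }

/-- Run B's input point of the non-holomorphic toy is the base point `(0, 0)` (same data as `actModel`). [folklore] -/
theorem actC_pointB (g : ℕ → ℝ) (U : toyCarriers.BgB) (X : toyCarriers.Dom) :
    actModelC.pointB actEB g U X = (0, 0) :=
  act_pointB g U X

/-- Run A's input point of the non-holomorphic toy (same data as `actModel`; both coordinates REAL). [folklore] -/
theorem actC_pointA (g : ℕ → ℝ) (U : toyCarriers.BgB) (X : toyCarriers.Dom) :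
    actModelC.pointA actEA g U X =
      ((((1 / 2 : ℝ) ^ toyCarriers.scale X : ℝ) : ℂ), ((actFeed (toyCarriers.scale X) (fun j => actE j) : ℝ) : ℂ)) :=
  act_pointA g U X

/-- Non-holomorphic toy: `Realizes` holds — at the real input points `conj` is invisible, the realized activities are
`actRep`'s (run A: the genuine recursion `r_k`; run B: `0`). [folklore] -/
theorem actC_realizes : actModelC.Realizes actEA actEB Set.univ := by
  intro g _ U X γ hγ
  have hγ' : γ = toyCarriers.scale X := Finset.mem_singleton.1 hγ
  refine ⟨?_, ?_⟩
  · rw [actC_pointB]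
    show 1 / 8 * conj (0 : ℂ) * (1 + 0) = 0
    rw [map_zero]; ring
  · rw [actC_pointA, hγ']
    show 1 / 8 * conj ((((1 / 2 : ℝ) ^ toyCarriers.scale X : ℝ) : ℂ)) *
        (1 + ((actFeed (toyCarriers.scale X) (fun j => actE j) : ℝ) : ℂ)) = (actR (toyCarriers.scale X) : ℂ)
    rw [Complex.conj_ofReal]
    unfold actR
    push_cast
    ring

/-- Non-holomorphic toy: run B's input point is admissible. [folklore] -/
theorem actC_inBase : actModelC.InBase actEB Set.univ := by
  intro g _ U X
  rw [actC_pointB]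
  rfl

/-- Non-holomorphic toy: one-run majorant `1/4` at the admissible point. [folklore] -/
theorem actC_baseMajorant : actModelC.BaseMajorant Set.univ (fun _ _ _ => 1 / 4) := by
  intro g _ U X p hp γ _
  have hp' : p = (0, 0) := hp
  subst hp'
  show ‖1 / 8 * conj (0 : ℂ) * (1 + 0)‖ ≤ 1 / 4
  rw [map_zero]; norm_num

/-- Non-holomorphic toy: the ACTIVITY-LIPSCHITZ DATUM with the exact modulus `Λ = 1/2` at every reach `ρ₀ ≤ 1`
(`‖conj q₁‖ = ‖q₁‖`; same arithmetic as `act_activityLipschitz`) — a two-point datum blind to holomorphy. [folklore] -/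
theorem actC_activityLipschitz {ρ₀ : ℝ} (hρ₀ : ρ₀ ≤ 1) :
    actModelC.ActivityLipschitz Set.univ (fun _ _ _ => 1 / 4) (1 / 2) ρ₀ := by
  intro g _ U X p hp q hq γ _
  have hp' : p = (0, 0) := hp
  subst hp'
  have hrel : relDisc q ((0 : ℂ), (0 : ℂ)) (actModelC.ϱOp X) (actModelC.ϱHist X) = ‖q.1‖ + ‖q.2‖ := by
    show ‖q.1 - 0‖ / 1 + ‖q.2 - 0‖ / 1 = ‖q.1‖ + ‖q.2‖
    rw [sub_zero, sub_zero, div_one, div_one]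
  rw [hrel] at hq ⊢
  show ‖1 / 8 * conj q.1 * (1 + q.2) - 1 / 8 * conj (0 : ℂ) * (1 + 0)‖ ≤ 1 / 2 * (‖q.1‖ + ‖q.2‖) * (1 / 4)
  have h1 : ‖q.1‖ ≤ 1 := by linarith [norm_nonneg q.2]
  have h2 : ‖q.1‖ * ‖q.2‖ ≤ ‖q.2‖ := by nlinarith [norm_nonneg q.2, norm_nonneg q.1]
  have h3 : ‖1 + q.2‖ ≤ 1 + ‖q.2‖ := (norm_add_le _ _).trans (by rw [norm_one])
  calc ‖1 / 8 * conj q.1 * (1 + q.2) - 1 / 8 * conj (0 : ℂ) * (1 + 0)‖ = 1 / 8 * (‖q.1‖ * ‖1 + q.2‖) := by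
        rw [map_zero, mul_zero, zero_mul, sub_zero, norm_mul, norm_mul, Complex.norm_conj]
        norm_num
        ring
    _ ≤ 1 / 8 * (‖q.1‖ * (1 + ‖q.2‖)) := by gcongr
    _ ≤ 1 / 2 * (‖q.1‖ + ‖q.2‖) * (1 / 4) := by nlinarith [norm_nonneg q.1]

/-- **The analytic wall FAILS on the non-holomorphic toy, for EVERY majorant and size data** (kernel): `BoxKP` asks
the activities to be complex differentiable on the box around the admissible point `(0, 0)`; along the operator axis
the toy activity is `o ↦ conj(o)/8`, complex differentiable nowhere (`not_differentiableAt_conj`). [folklore] -/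
theorem actC_not_boxKP (m : (ℕ → ℝ) → toyCarriers.BgB → actRep.P → ℝ) (a d : actRep.P → ℝ) :
    ¬ actModelC.BoxKP Set.univ m a d := by
  rintro ⟨-, -, h⟩
  have hbase : ((0 : ℂ), (0 : ℂ)) ∈ actModelC.Base (fun _ => 1) () (0 : ℕ) := rfl
  obtain ⟨hdiff, -⟩ := (h (fun _ => 1) (Set.mem_univ _) () (0 : ℕ)).1 ((0 : ℂ), (0 : ℂ)) hbase
  have hγ : (0 : ℕ) ∈ actRep.vol (0 : ℕ) := Finset.mem_singleton_self _
  have hd := hdiff (0 : ℕ) hγ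
  have hopen : IsOpen (actModelC.box (0 : ℕ) ((0 : ℂ), (0 : ℂ))) := isOpen_ball.prod isOpen_ball
  have hat : DifferentiableAt ℂ (actModelC.Ψ (fun _ => 1) () (0 : ℕ) (0 : ℕ)) ((0 : ℂ), (0 : ℂ)) :=
    hd.differentiableAt (hopen.mem_nhds (actModelC.mem_box_self _ _))
  have hg : DifferentiableAt ℂ (fun o : ℂ => ((o, 0) : ℂ × ℂ)) 0 :=
    differentiableAt_id.prodMk (differentiableAt_const (0 : ℂ))
  have hline : DifferentiableAt ℂ (fun o : ℂ => actModelC.Ψ (fun _ => 1) () (0 : ℕ) (0 : ℕ) (o, 0)) 0 :=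
    DifferentiableAt.comp (f := fun o : ℂ => ((o, 0) : ℂ × ℂ)) (0 : ℂ) hat hg
  have hconj : DifferentiableAt ℂ (fun o : ℂ => conj o) 0 := by
    have hfun : (fun o : ℂ => conj o) = fun o => (8 : ℂ) * actModelC.Ψ (fun _ => 1) () (0 : ℕ) (0 : ℕ) (o, 0) := by
      funext o
      show conj o = 8 * (1 / 8 * conj o * (1 + 0))
      ring
    rw [hfun]
    exact hline.const_mul _
  exact not_differentiableAt_conj 0 hconj

/-- Same data as `actModel` away from `Ψ`: the operator rate transfers verbatim. [folklore] -/
theorem actC_operatorRate : actModelC.OperatorRate Set.univ 1 (1 / 2) := act_operatorRate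

/-- Same data: the insertion rate transfers verbatim. [folklore] -/
theorem actC_insertionRate : actModelC.InsertionRate Set.univ 0 0 0 (1 / 2) := act_insertionRate

/-- Same data: affine insertion. [folklore] -/
theorem actC_insAffine : actModelC.InsAffine Set.univ := act_insAffine

/-- Same data: scale-blind insertion. [folklore] -/
theorem actC_insBlind : actModelC.InsBlind Set.univ := act_insBlind

/-- Same data: homogeneous insertion. [folklore] -/
theorem actC_insHomog : actModelC.InsHomog Set.univ := act_insHomog

/-- Same data: the single-scale insertion bound. [folklore] -/
theorem actC_insScaleBound {E₁ ω : ℝ} (hE₁ : 0 ≤ E₁) (hω : 0 ≤ ω) :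
    actModelC.InsScaleBound Set.univ 0 E₁ (1 / 16) ω :=
  act_insScaleBound hE₁ hω

/-- **CLASS SEPARATION BY KIND, CERTIFIED** (kernel): on the non-holomorphic toy EVERY hypothesis of the
Lipschitz-currency closure `InputModel.ne5_of_model_actLip_scale_nat` holds (same constants as `act_ne5_actLip`:
`A = 1`, `A₀ = 1/4`, `E₀ = 0`, `E₁ = 1`, `κ = 0`, `δ = 1`, `δ′ = 0`, `θ = 1/2`, `c = ω = 1/16`, majorant `1/4`,
`s = 2/5`, `Λ = 1/2`, `k₀ = 2`, `ρ₀ = 4/15`, `B = 1/2`), so NE5 follows at rate `1/2` with constant `133/41` — while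
`actC_not_boxKP` shows that NO closure through the analytic box wall (`ne5_of_model`, `…_near`, `…_scale_near_nat`,
§2–§7 of `T4ActivityRecursion`) can be instantiated on this model with any majorant whatsoever.  The re-typed wall
`BaseMajorant ∧ KPInflated ∧ ActivityLipschitz` is therefore STRICTLY weaker than `BoxKP` as a class of models (not
only in modulus and reach, `act_activityLipschitz_sharp`). [folklore] -/
theorem actC_ne5_actLip : NE5 actEA actEB (Set.univ : Set (ℕ → ℝ)) 0 (1 / 2)
    ((1 * (1 / 2) / (2 / 5 - 1 / 2 * (4 / 15)) * (1 + 0) + 1 / 2) * (1 / 2 - 1 / 16) /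
      (1 / 2 - (1 / 16 + 1 * (1 / 2) / (2 / 5 - 1 / 2 * (4 / 15)) * (1 / 16)))) :=
  actModelC.ne5_of_model_actLip_scale_nat (k₀ := 2) (ρ₀ := 4 / 15) (B := 1 / 2) act_represents actC_realizes
    actC_inBase actC_baseMajorant act_kpInflated (actC_activityLipschitz (by norm_num)) act_decayExtract act_pinBudget
    act_decayA act_decayB actC_operatorRate actC_insertionRate actC_insAffine actC_insBlind actC_insHomog
    (actC_insScaleBound zero_le_one (by norm_num : (0 : ℝ) ≤ 1 / 16)) one_pos zero_le_one (by norm_num) (by norm_num)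
    (by norm_num) (by norm_num) (by norm_num) (by norm_num) (by norm_num) (by norm_num) (by norm_num)
    (fun k hk => by
      interval_cases k <;> norm_num)
    (by norm_num)

/-- The separation in one line: a model of the re-typed wall (with NE5 concluded) that is a model of the analytic wall
for NO data. [folklore] -/
theorem actC_separation :
    (actModelC.BaseMajorant Set.univ (fun _ _ _ => 1 / 4) ∧
      KPInflated actRep Set.univ (fun _ _ _ => 1 / 4) (2 / 5) (fun _ => 1) (fun _ => 0) ∧
      actModelC.ActivityLipschitz Set.univ (fun _ _ _ => 1 / 4) (1 / 2) 1) ∧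
    ∀ m a d, ¬ actModelC.BoxKP Set.univ m a d :=
  ⟨⟨actC_baseMajorant, act_kpInflated, actC_activityLipschitz le_rfl⟩, actC_not_boxKP⟩

end ToyNonHolomorphic

/-! ## §6 (file v1.3, ADDITIVE) The toy's TWO-SPECIES datum (operator modulus ½, history modulus ρ₀/2 at reach ρ₀) and
the species closure `InputModel.ne5_of_model_actLip₂_scale_nat` of `T4ActivityRecursion` v1.4 §9.2 exercised -/

section ToySpecies

/-- Toy: the TWO-SPECIES activity-Lipschitz datum.  The toy activity `q₁(1 + q₂)/8` feels the inserted history only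
through the cross term `q₁q₂/8`, so around the admissible point `(0, 0)` its history sensitivity is proportional to the
operator displacement: at reach `ρ₀` the OPERATOR modulus is `1/2` (as in `act_activityLipschitz`) while the HISTORY
modulus is any `Λh ≥ ρ₀/2` — `|q₁(1 + q₂)|/8 ≤ (|q₁| + |q₁||q₂|)/8 ≤ (½|q₁| + Λh|q₂|)·¼` because `|q₁| ≤ ρ₀ ≤ 2Λh`.
[folklore] -/
theorem act_activityLipschitz₂ {ρ₀ Λh : ℝ} (hρ₀ : ρ₀ ≤ 2 * Λh) :
    actModel.ActivityLipschitz₂ Set.univ (fun _ _ _ => 1 / 4) (1 / 2) Λh ρ₀ := by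
  intro g _ U X p hp q hq γ _
  have hp' : p = (0, 0) := hp
  subst hp'
  have hrel : relDisc q ((0 : ℂ), (0 : ℂ)) (actModel.ϱOp X) (actModel.ϱHist X) = ‖q.1‖ + ‖q.2‖ := by
    show ‖q.1 - 0‖ / 1 + ‖q.2 - 0‖ / 1 = ‖q.1‖ + ‖q.2‖
    rw [sub_zero, sub_zero, div_one, div_one]
  rw [hrel] at hq
  show ‖1 / 8 * q.1 * (1 + q.2) - 1 / 8 * 0 * (1 + 0)‖ ≤ (1 / 2 * (‖q.1 - 0‖ / 1) + Λh * (‖q.2 - 0‖ / 1)) * (1 / 4)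
  rw [sub_zero, sub_zero, div_one, div_one]
  have h1 : ‖q.1‖ ≤ 2 * Λh := by linarith [norm_nonneg q.2]
  have h2 : ‖q.1‖ * ‖q.2‖ ≤ 2 * Λh * ‖q.2‖ := by nlinarith [norm_nonneg q.2, norm_nonneg q.1]
  have h3 : ‖1 + q.2‖ ≤ 1 + ‖q.2‖ := (norm_add_le _ _).trans (by rw [norm_one])
  calc ‖1 / 8 * q.1 * (1 + q.2) - 1 / 8 * 0 * (1 + 0)‖ = 1 / 8 * (‖q.1‖ * ‖1 + q.2‖) := by
        rw [mul_zero, zero_mul, sub_zero, norm_mul, norm_mul]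
        norm_num
        ring
    _ ≤ 1 / 8 * (‖q.1‖ * (1 + ‖q.2‖)) := by gcongr
    _ ≤ (1 / 2 * ‖q.1‖ + Λh * ‖q.2‖) * (1 / 4) := by nlinarith [norm_nonneg q.1]

/-- **The species closure exercised**: every hypothesis of `InputModel.ne5_of_model_actLip₂_scale_nat` holds on the toy
with OPERATOR modulus `Λop = 1/2`, HISTORY modulus `Λhist = 1/4` at reach `ρ₀ = 1/2` (`act_activityLipschitz₂`), regauge
`l = Λhist/Λop = 1/2`, regauged reach `ρ₀′ = 4/15` (`max(l, 1)·ρ₀′ = 4/15 ≤ 1/2`), `k₀ = 3` — the near condition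
`(1/l)(1/2)³ + (1/16)(1/4)/(15/16) = 1/4 + 1/60 = 4/15` holds with EQUALITY — `B = 1` (`¼ ≤ (1/2)^k` for `k < 3`, equality
at `k = 2`), the other constants as in `act_ne5_actLip` (`A = 1`, `A₀ = 1/4`, `E₀ = 0`, `E₁ = 1`, `κ = 0`, `δ = 1`,
`δ′ = 0`, `θ = 1/2`, `c = ω = 1/16`, majorant `1/4`, inflation `s = 2/5`); key constant `K′ = AΛhist/(s − Λhist ρ₀′) =
(1/4)/(1/3) = 3/4` against the single-species `15/8`, feedback gain `K′c = 3/64` against `15/128`, smallness `1/16 + 3/64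
= 7/64 < 1/2`; NE5 at rate `1/2` with the closure's constant (`= 14/5`, next example, against `133/41`): on the toy the
species split improves BOTH the exponent-critical gain and the constant, because the history modulus near the base point
is genuinely smaller than the operator modulus. [folklore] -/
theorem act_ne5_actLip₂ : NE5 actEA actEB (Set.univ : Set (ℕ → ℝ)) 0 (1 / 2)
    ((1 * (1 / 4) / (2 / 5 - 1 / 4 * (4 / 15)) * (1 / (1 / 4 / (1 / 2)) + 0) + 1) * (1 / 2 - 1 / 16) /
      (1 / 2 - (1 / 16 + 1 * (1 / 4) / (2 / 5 - 1 / 4 * (4 / 15)) * (1 / 16)))) :=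
  actModel.ne5_of_model_actLip₂_scale_nat (k₀ := 3) (ρ₀ := 1 / 2) (ρ₀' := 4 / 15) (B := 1) (Λop := 1 / 2)
    (Λhist := 1 / 4) act_represents act_realizes act_inBase act_baseMajorant act_kpInflated
    (act_activityLipschitz₂ (by norm_num)) act_decayExtract act_pinBudget act_decayA act_decayB act_operatorRate
    act_insertionRate act_insAffine act_insBlind act_insHomog
    (act_insScaleBound zero_le_one (by norm_num : (0 : ℝ) ≤ 1 / 16)) one_pos zero_le_one (by norm_num) (by norm_num)
    (by rw [max_eq_right (by norm_num)]; norm_num) (by norm_num) (by norm_num) (by norm_num) (by norm_num) (by norm_num)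
    (by norm_num) (by norm_num) (by norm_num) (by norm_num)
    (fun k hk => by
      interval_cases k <;> norm_num)
    (by norm_num)

/-- The species constant in lowest terms. [folklore] -/
example : (((1 * (1 / 4) / (2 / 5 - 1 / 4 * (4 / 15)) * (1 / (1 / 4 / (1 / 2)) + 0) + 1) * (1 / 2 - 1 / 16) /
      (1 / 2 - (1 / 16 + 1 * (1 / 4) / (2 / 5 - 1 / 4 * (4 / 15)) * (1 / 16)))) : ℝ) = 14 / 5 := by
  norm_num

/-- The toy NE5 from the species datum, unfolded: `0 < E_A(k) ≤ (14/5)(1/2)^k`. [folklore] -/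
theorem act_disc_le_actLip₂ (k : ℕ) : actE k ≤ 14 / 5 * (1 / 2 : ℝ) ^ k := by
  have hc : (((1 * (1 / 4) / (2 / 5 - 1 / 4 * (4 / 15)) * (1 / (1 / 4 / (1 / 2)) + 0) + 1) * (1 / 2 - 1 / 16) /
      (1 / 2 - (1 / 16 + 1 * (1 / 4) / (2 / 5 - 1 / 4 * (4 / 15)) * (1 / 16)))) : ℝ) = 14 / 5 := by
    norm_num
  have h := act_ne5_actLip₂ (fun _ => 1) (Set.mem_univ _) () k
  rw [hc] at h
  change |actE k - 0| ≤ 14 / 5 * (1 / 2 : ℝ) ^ k * Real.exp (-(0 * (0 : ℝ))) at h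
  rw [sub_zero, abs_of_pos (actE_pos k), zero_mul, neg_zero, Real.exp_zero, mul_one] at h
  exact h

end ToySpecies

end Literature.MathematicalPhysics.QuantumFieldTheory.Balaban1983to89.T4ActivityRecursionWitness
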